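import Literature.MathematicalPhysics.KineticTheory.HardSphereEEPNormalisation
import Literature.MathematicalPhysics.KineticTheory.EntropyProductionIntegrable
import HarnessLib

/-!
# Gaussian domination of the normalised cloud laws of `HardSphereEEP`

The normalised law `f̃ = cloudLawNormalised p v h δ` of a weighted velocity cloud (a Gaussian mixture
of width `σ = h/√T ≤ 1` mixed with `δ M_{1,0,1}`, `HardSphereEEPNormalisation`) satisfies the two
hypotheses of `integrable_epIntegrand` (`EntropyProductionIntegrable`):

* `cloudLawNormalised_le_gaussian`: a Gaussian envelope `f̃ ≤ K · M_{1,0,2}` (each component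
  `M_{1,c,σ²} ≤ (2πσ²)^{-3/2} (4π)^{3/2} e^{|c|²/(2σ²)} M_{1,0,2}` for `σ ≤ 1`, from
  `|w - c|² ≥ |w|²/2 - |c|²`);
* `abs_log_cloudLawNormalised_le`: `|log f̃(w)| ≤ A + |w|²/2` (lower bound `f̃ ≥ δ M_{1,0,1}`, upper
  bound from the envelope);

hence `integrable_epIntegrand_cloudLawNormalised`: the entropy production `D(f̃)` appearing in
`HardSphereEEP` (after normalisation, `entropyProduction_cloudLaw`) is a convergent integral.
-/

namespace Literature.MathematicalPhysics.KineticTheory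

open _root_.MeasureTheory Real Finset
open scoped InnerProductSpace BigOperators
open Literature.Analysis.FluidPDE (localMaxwellian entropyProduction)

noncomputable section

variable {n : ℕ}

/-- One Gaussian of width `σ ≤ 1` (`0 < θ = σ² ≤ 1`) under the envelope `M_{1,0,2}`:
`M_{1,c,θ}(w) ≤ (2πθ)^{-3/2} (4π)^{3/2} e^{|c|²/(2θ)} · M_{1,0,2}(w)`. [folklore] -/
theorem localMaxwellian_le_envelope {θ : ℝ} (hθ : 0 < θ) (hθ1 : θ ≤ 1) (c w : V3) :
    localMaxwellian 1 θ c w ≤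
      ((2 * π * θ) ^ (-(3 : ℝ) / 2) * (4 * π) ^ ((3 : ℝ) / 2) * Real.exp (‖c‖ ^ 2 / (2 * θ))) *
        localMaxwellian 1 2 0 w := by
  have hd : (Module.finrank ℝ V3 : ℝ) = 3 := by simp
  unfold Literature.Analysis.FluidPDE.localMaxwellian
  rw [hd, sub_zero, one_mul, one_mul]
  -- exponent comparison: -|w-c|²/(2θ) ≤ |c|²/(2θ) - |w|²/4
  have hexp : -‖w - c‖ ^ 2 / (2 * θ) ≤ ‖c‖ ^ 2 / (2 * θ) + -‖w‖ ^ 2 / (2 * 2) := by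
    have h1 : ‖w‖ ^ 2 ≤ 2 * ‖w - c‖ ^ 2 + 2 * ‖c‖ ^ 2 := by
      have h0 := norm_add_le (w - c) c
      rw [sub_add_cancel] at h0
      have h0' : ‖w‖ ^ 2 ≤ (‖w - c‖ + ‖c‖) ^ 2 := by gcongr
      nlinarith [sq_nonneg (‖w - c‖ - ‖c‖)]
    have h2 : ‖w‖ ^ 2 / (2 * 2) ≤ ‖w‖ ^ 2 / (4 * θ) := by
      rw [show (2 * 2 : ℝ) = 4 by norm_num]
      exact div_le_div_of_nonneg_left (sq_nonneg _) (by positivity) (by nlinarith)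
    have h3 : ‖w‖ ^ 2 / (4 * θ) ≤ (2 * ‖w - c‖ ^ 2 + 2 * ‖c‖ ^ 2) / (4 * θ) :=
      div_le_div_of_nonneg_right h1 (by positivity)
    have h4 : (2 * ‖w - c‖ ^ 2 + 2 * ‖c‖ ^ 2) / (4 * θ) = ‖w - c‖ ^ 2 / (2 * θ) + ‖c‖ ^ 2 / (2 * θ) := by
      field_simp
      ring
    rw [neg_div, neg_div]
    linarith
  have hmono := Real.exp_le_exp.2 hexp
  rw [Real.exp_add] at hmono
  have hpre : 0 ≤ (2 * π * θ) ^ (-(3 : ℝ) / 2) := by positivity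
  calc (2 * π * θ) ^ (-(3 : ℝ) / 2) * Real.exp (-‖w - c‖ ^ 2 / (2 * θ))
      ≤ (2 * π * θ) ^ (-(3 : ℝ) / 2) * (Real.exp (‖c‖ ^ 2 / (2 * θ)) * Real.exp (-‖w‖ ^ 2 / (2 * 2))) :=
        mul_le_mul_of_nonneg_left hmono hpre
    _ = (2 * π * θ) ^ (-(3 : ℝ) / 2) * (4 * π) ^ ((3 : ℝ) / 2) * Real.exp (‖c‖ ^ 2 / (2 * θ)) *
          ((2 * π * 2) ^ (-(3 : ℝ) / 2) * Real.exp (-‖w‖ ^ 2 / (2 * 2))) := by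
        have h4 : (4 * π : ℝ) ^ ((3 : ℝ) / 2) * (2 * π * 2) ^ (-(3 : ℝ) / 2) = 1 := by
          rw [show (2 * π * 2 : ℝ) = 4 * π by ring, ← Real.rpow_add (by positivity)]
          norm_num
        calc (2 * π * θ) ^ (-(3 : ℝ) / 2) * (Real.exp (‖c‖ ^ 2 / (2 * θ)) * Real.exp (-‖w‖ ^ 2 / (2 * 2)))
            = (2 * π * θ) ^ (-(3 : ℝ) / 2) * Real.exp (‖c‖ ^ 2 / (2 * θ)) *
                ((4 * π : ℝ) ^ ((3 : ℝ) / 2) * (2 * π * 2) ^ (-(3 : ℝ) / 2)) *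
                  Real.exp (-‖w‖ ^ 2 / (2 * 2)) := by rw [h4]; ring
          _ = _ := by ring

/-- **Gaussian envelope of the normalised cloud law**: `f̃ ≤ K · M_{1,0,2}` with an explicit
`K = K(cloud)` (`0 ≤ δ ≤ 1`, `p_i ≥ 0`, `h ≠ 0`; the width `σ² = h²/T ≤ 1` by `sq_le_cloudTemp`).
[folklore] -/
theorem cloudLawNormalised_le_gaussian (p : Fin n → ℝ) (v : Fin n → V3) {h δ : ℝ} (hh : h ≠ 0)
    (hδ0 : 0 ≤ δ) (hδ : δ ≤ 1) (hp : ∀ i, 0 ≤ p i) :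
    ∃ K : ℝ, ∀ w, cloudLawNormalised p v h δ w ≤ K * localMaxwellian 1 2 0 w := by
  have hT := cloudTemp_pos p v hh hp
  set a := Real.sqrt (cloudTemp p v h) with ha
  have ha0 : 0 < a := Real.sqrt_pos.2 hT
  set θ := (h / a) ^ 2 with hθ
  have hθ0 : 0 < θ := by positivity
  have hθ1 : θ ≤ 1 := by
    rw [hθ, div_pow, Real.sq_sqrt hT.le, div_le_one hT]
    exact sq_le_cloudTemp p v h hp
  set c : Fin n → V3 := fun i => a⁻¹ • (v i - cloudMean p v) with hc
  set Ki : Fin n → ℝ := fun i =>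
    (2 * π * θ) ^ (-(3 : ℝ) / 2) * (4 * π) ^ ((3 : ℝ) / 2) * Real.exp (‖c i‖ ^ 2 / (2 * θ)) with hKi
  have hM1 : ∀ w : V3, localMaxwellian 1 1 0 w ≤
      ((2 * π * 1) ^ (-(3 : ℝ) / 2) * (4 * π) ^ ((3 : ℝ) / 2) * Real.exp (‖(0 : V3)‖ ^ 2 / (2 * 1))) *
        localMaxwellian 1 2 0 w := fun w => localMaxwellian_le_envelope one_pos le_rfl 0 w
  refine ⟨(1 - δ) * ∑ i, p i * Ki i +
    δ * ((2 * π * 1) ^ (-(3 : ℝ) / 2) * (4 * π) ^ ((3 : ℝ) / 2) * Real.exp (‖(0 : V3)‖ ^ 2 / (2 * 1))),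
    fun w => ?_⟩
  unfold cloudLawNormalised
  rw [add_mul, mul_assoc, mul_assoc δ, Finset.sum_mul]
  refine add_le_add (mul_le_mul_of_nonneg_left (Finset.sum_le_sum fun i _ => ?_) (by linarith))
    (mul_le_mul_of_nonneg_left (hM1 w) hδ0)
  rw [mul_assoc]
  exact mul_le_mul_of_nonneg_left (localMaxwellian_le_envelope hθ0 hθ1 (c i) w) (hp i)

/-- **At most quadratic logarithm**: `|log f̃(w)| ≤ A + |w|²/2` for the normalised cloud law
(`0 < δ ≤ 1`). [folklore] -/
theorem abs_log_cloudLawNormalised_le (p : Fin n → ℝ) (v : Fin n → V3) {h δ : ℝ} (hh : h ≠ 0)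
    (hδ0 : 0 < δ) (hδ : δ ≤ 1) (hp : ∀ i, 0 ≤ p i) :
    ∃ A : ℝ, ∀ w, |log (cloudLawNormalised p v h δ w)| ≤ A + 2⁻¹ * ‖w‖ ^ 2 := by
  obtain ⟨K, hK⟩ := cloudLawNormalised_le_gaussian p v hh hδ0.le hδ hp
  have hd : (Module.finrank ℝ V3 : ℝ) = 3 := by simp
  -- the upper bound `f̃ ≤ K (4π)^{-3/2}` and the lower bound `f̃ ≥ δ (2π)^{-3/2} e^{-|w|²/2}`
  set U : ℝ := K * (2 * π * 2) ^ (-(3 : ℝ) / 2) with hU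
  set L : ℝ := δ * (2 * π) ^ (-(3 : ℝ) / 2) with hL
  have hLpos : 0 < L := by positivity
  refine ⟨max |log U| |log L|, fun w => ?_⟩
  have hfpos := cloudLawNormalised_pos p v h hδ0 hδ hp w
  have hup : cloudLawNormalised p v h δ w ≤ U := by
    refine (hK w).trans ?_
    have hM : localMaxwellian 1 2 0 w ≤ (2 * π * 2) ^ (-(3 : ℝ) / 2) := by
      unfold Literature.Analysis.FluidPDE.localMaxwellian
      rw [hd, one_mul]
      exact mul_le_of_le_one_right (by positivity) (Real.exp_le_one_iff.2
        (div_nonpos_of_nonpos_of_nonneg (neg_nonpos.2 (sq_nonneg _)) (by positivity)))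
    have hK0 : 0 ≤ K := by
      by_contra hneg
      push Not at hneg
      have := hfpos.trans_le (hK w)
      nlinarith [mul_neg_of_neg_of_pos hneg (localMaxwellian_pos one_pos two_pos (0 : V3) w)]
    exact mul_le_mul_of_nonneg_left hM hK0
  have hlow : L * Real.exp (-‖w‖ ^ 2 / 2) ≤ cloudLawNormalised p v h δ w := by
    refine le_trans (le_of_eq ?_) (cloudLawNormalised_ge p v h hδ hp w)
    unfold Literature.Analysis.FluidPDE.localMaxwellian
    rw [hd, hL, sub_zero, mul_one, one_mul, mul_one, mul_assoc]
  have hUpos : 0 < U := lt_of_lt_of_le hfpos hup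
  rw [abs_le]
  constructor
  · -- lower: log f̃ ≥ log L - |w|²/2
    have h1 := Real.log_le_log (by positivity) hlow
    rw [Real.log_mul hLpos.ne' (Real.exp_pos _).ne', Real.log_exp] at h1
    have h2 : -|log L| ≤ log L := neg_abs_le _
    have h3 : |log L| ≤ max |log U| |log L| := le_max_right _ _
    nlinarith [sq_nonneg ‖w‖]
  · have h1 := Real.log_le_log hfpos hup
    have h2 : log U ≤ |log U| := le_abs_self _
    have h3 : |log U| ≤ max |log U| |log L| := le_max_left _ _
    nlinarith [sq_nonneg ‖w‖]

/-- The normalised cloud law is continuous. [folklore] -/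
theorem continuous_cloudLawNormalised (p : Fin n → ℝ) (v : Fin n → V3) (h δ : ℝ) :
    Continuous (cloudLawNormalised p v h δ) := by
  unfold cloudLawNormalised
  refine (continuous_const.mul (continuous_finsetSum _ fun i _ =>
    continuous_const.mul (continuous_localMaxwellian _ _ _))).add
      (continuous_const.mul (continuous_localMaxwellian _ _ _))

/-- **`D(f̃)` is a convergent integral**: the entropy-production integrand of the normalised cloud
law is integrable on `ℝ³ × ℝ³ × S²` (`0 < δ ≤ 1`, `p_i ≥ 0`, `h ≠ 0`). [folklore] -/
theorem integrable_epIntegrand_cloudLawNormalised (p : Fin n → ℝ) (v : Fin n → V3) {h δ : ℝ}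
    (hh : h ≠ 0) (hδ0 : 0 < δ) (hδ : δ ≤ 1) (hp : ∀ i, 0 ≤ p i) :
    Integrable (epIntegrand (cloudLawNormalised p v h δ))
      (((volume : Measure V3).prod volume).prod sphereMeasure) := by
  obtain ⟨K, hK⟩ := cloudLawNormalised_le_gaussian p v hh hδ0.le hδ hp
  obtain ⟨A, hA⟩ := abs_log_cloudLawNormalised_le p v hh hδ0 hδ hp
  exact integrable_epIntegrand (continuous_cloudLawNormalised p v h δ)
    (cloudLawNormalised_pos p v h hδ0 hδ hp) two_pos hK hA

end

end Literature.MathematicalPhysics.KineticTheory
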